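import Literature.NumberTheory.EllipticCurves.DescendedFrobeniusMatrix
import Literature.NumberTheory.EllipticCurves.FormalGroupLogHomAbelProofs
import Literature.NumberTheory.EllipticCurves.FormalGroupNegOmegaProofs
import Summits.BirchSwinnertonDyer.BirchSwinnertonDyer.Theorems.CyclotomicUntwistFormalEtaResidue
import HarnessLib

/-!
# Route `CyclotomicUntwist`: the class of `η = x·ω` is of the SECOND KIND — Part I (preparations): the derivative
# of `formalEtaIntegral`, the Vieta product `D·w₁w₂w₃ = ν³`, the differentiated incidences, and the algebraic bridge

Cell `pub/bsd-wall` (D-0145 line `route-BirchSwinnertonDyer-CyclotomicUntwist`), prover seat `bsd-line-cycu-p5`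
(gen 10), lane «the η-class is of the second kind». THEOREMS ONLY (no definition, no named fact, no `sorry`);
helper `--supports` K1 = stmt-BirchSwinnertonDyer-21580 (serves K2 = 21581 and the print input
`isDescendedFrobeniusMatrix_exists` of C2 = 27549). BSD is not proved by this file and no crux is.

WHAT. The Literature definition `WeierstrassCurve.formalEtaIntegral` (`DescendedFrobeniusMatrix.lean`) represents the
de Rham class of `η = x·ω` in Katz's module `D(Ê/R) = {f : f(0) = 0, df integral, ∂f integral}/{integral}`
([Katz 1981, §5.1 p. 193]) by the regular series `L_η = ∫(xω − dz/z²) = Σ_{n ≥ 1} (P_{n+1}/n) zⁿ`,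
`P = z²x·(ω/dz)`. For `[η]` to BE an element of `D(Ê/R)` its coboundary
`∂L_η := L_η(F(z₁,z₂)) − L_η(z₁) − L_η(z₂)` (`F = formalGroupLaw`, AEC IV.1) must have coefficients in `R`
(primitivity; the `[ω]`-half is `log F = log z₁ + log z₂`, `formalLog_subst_formalGroupLaw`). Part II
(`CyclotomicUntwistFormalEtaCoboundary.lean`) proves the CLOSED FORM, for every Weierstrass curve over a `ℚ`-algebra domain,

  `∂L_η = a₁ − (a₁ + a₃λ + a₄ν + 2a₆λν)·(1 − a₃ν − a₆ν²)⁻¹ + a₃·z₃²·B(z₃)`     (`formalEtaIntegral_coboundary_eq`)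

(`λ = formalSlope`, `ν = formalIntercept`, `z₃ = formalChordZ`, `B = formalWDivCube`, all with coefficients in
`ℤ[a₁,…,a₆]`), i.e. the `z`-expansion of the classical addition law of the Weierstrass `ζ`-function
`ζ(u+v) − ζ(u) − ζ(v) = ½(℘′(u) − ℘′(v))/(℘(u) − ℘(v))` with the polar parts `1/z` removed:
`∂L_η = 1/F − 1/z₁ − 1/z₂ − λ/ν` (`λ/ν` = the `(x,y)`-slope of the chord), rewritten through Vieta for the chord
cubic (`D·z₁z₂z₃ = ν(1 − a₃ν − a₆ν²)`, `D·(z₁z₂ + z₁z₃ + z₂z₃) = c₁`) into a power series. PROOF: both sides vanish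
at `z = 0` and have the same partial derivatives: `ηᵢ·∂ᵢ(∂L_η) = q(F) − q(zᵢ)` with `q = (z²x − η)/z²`
(invariance `ηᵢ∂ᵢF = η(F)`), while `∂ᵢ` of the right side is computed from `ηᵢ∂ᵢλ = D(zᵢ − z₃)`,
`∂ᵢν = −zⱼ∂ᵢλ` (the differentiated incidences) and reduces, after clearing denominators, to `x(F) − xᵢ =
ν(z₃ − zᵢ)/(wᵢw₃)` and the Vieta product `D·w₁w₂w₃ = ν³`. CONSEQUENCE (`coeff_coboundary_mem_range`): for a
Weierstrass equation with coefficients in a subring `R → A`, every coefficient of `∂L_η` lies in `R` — in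
particular for a good model over `𝓞 = 𝓞_{ℚ₃(ζ₉)}` the class `classEta` has `𝓞`-INTEGRAL coboundary
(`isIntegral_coeff_coboundary_formalEtaIntegral`), so `[η] ∈ D(Ê/𝓞)` (Katz L. 5.1.2 + primitivity, in kernel).
[cite: Katz1981CrystallineDieudonne, §5.1 (p. 193), Lemma 5.1.2] [cite: SilvermanAEC2009, IV.1, III.5.1]
-/

set_option autoImplicit false
-- single-conjunct summit: `Summit.BirchSwinnertonDyer.BirchSwinnertonDyer.…` repeats the name by design
set_option linter.dupNamespace false

noncomputable section

open PowerSeries Literature.NumberTheory.EllipticCurves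
open Literature.AlgebraicGeometry.Resolution (MvPowerSeries.pderiv MvPowerSeries.coeff_pderiv
  MvPowerSeries.pderiv_X MvPowerSeries.pderiv_C MvPowerSeries.pderiv_powerSeries_subst
  MvPowerSeries.pderiv_powerSeries_subst_X MvPowerSeries.coeff_eq_zero_of_pderiv_eq_zero)

namespace Summit.BirchSwinnertonDyer.BirchSwinnertonDyer.Theorems.FormalEtaCoboundary

/-! ## §1 One variable: the derivative `e = (P − 1)/z²` of `L_η` and `q = e·η = (z²x − η)/z²` -/

section OneVariable

variable {A : Type*} [CommRing A] [Algebra ℚ A] (W : WeierstrassCurve A)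

/-- `dL_η/dz = Σ_{n ≥ 0} P_{n+2} zⁿ` (term-by-term: `[zⁿ⁺¹]L_η = P_{n+2}/(n+1)`).
[cite: Katz1981CrystallineDieudonne, Lemma 5.1.2] -/
theorem derivative_formalEtaIntegral :
    d⁄dX A W.formalEtaIntegral = PowerSeries.mk fun n => coeff (n + 2) (W.formalXMulSq * W.formalOmega) := by
  ext n
  rw [coeff_derivative, W.coeff_succ_formalEtaIntegral, coeff_mk]
  have h : algebraMap ℚ A (1 / (n + 1 : ℚ)) * ((n : A) + 1) = 1 := by
    have h2 : ((n : A) + 1) = algebraMap ℚ A (n + 1 : ℚ) := by simp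
    rw [h2, ← map_mul, ← map_one (algebraMap ℚ A)]
    congr 1
    field_simp
  linear_combination coeff (n + 2) (W.formalXMulSq * W.formalOmega) * h

/-- `z² · (dL_η/dz) = P − 1` (`P₀ = 1`, `P₁ = 0`: the double pole and the residue of `x·ω` are removed).
[cite: Katz1981CrystallineDieudonne, Lemma 5.1.2] -/
theorem X_sq_mul_derivative_formalEtaIntegral :
    X ^ 2 * d⁄dX A W.formalEtaIntegral = W.formalXMulSq * W.formalOmega - 1 := by
  rw [derivative_formalEtaIntegral W]
  ext d
  rw [coeff_X_pow_mul', map_sub, coeff_one]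
  rcases Nat.lt_or_ge d 2 with hd | hd
  · rw [if_neg (by omega)]
    interval_cases d
    · rw [if_pos rfl, coeff_zero_eq_constantCoeff_apply,
        FormalEtaResidue.constantCoeff_formalXMulSq_mul_formalOmega, sub_self]
    · rw [if_neg one_ne_zero, FormalEtaResidue.coeff_one_formalXMulSq_mul_formalOmega, sub_zero]
  · rw [if_pos hd, coeff_mk, if_neg (by omega), sub_zero, Nat.sub_add_cancel hd]

/-- **`z² · (η · dL_η/dz) = z²x − η`**: with `ω·η = 1`, `η(P − 1) = z²x·ω·η − η = z²x − η`
(`z²x = formalXMulSq`, `η = formalEta`). [cite: SilvermanAEC2009, IV.1] -/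
theorem X_sq_mul_formalEta_mul_derivative_formalEtaIntegral :
    X ^ 2 * (W.formalEta * d⁄dX A W.formalEtaIntegral) = W.formalXMulSq - W.formalEta := by
  have h := X_sq_mul_derivative_formalEtaIntegral W
  linear_combination W.formalEta * h + W.formalXMulSq * W.formalOmega_mul_formalEta

end OneVariable

/-! ## §2 Two variables: Vieta products, the differentiated incidences, and the algebraic bridge -/

section TwoVariables

variable {R : Type*} [CommRing R] (W : WeierstrassCurve R)

/-- `zᵢ · zⱼ = z₁z₂` and `zᵢ + zⱼ = z₁ + z₂` for `zⱼ := z₁ + z₂ − zᵢ` (the other variable). [folklore] -/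
theorem X_mul_other (i : Fin 2) :
    (MvPowerSeries.X i : MvPowerSeries (Fin 2) R) *
        ((MvPowerSeries.X 0 : MvPowerSeries (Fin 2) R) + MvPowerSeries.X 1 - MvPowerSeries.X i) =
      MvPowerSeries.X 0 * MvPowerSeries.X 1 := by
  fin_cases i <;> simp [mul_comm]

/-- `λ zᵢ + ν = w(zᵢ)` for `i = 0, 1`. [cite: SilvermanAEC2009, IV.1.1] -/
theorem formalSlope_mul_X_add_formalIntercept (i : Fin 2) :
    W.formalSlope * (MvPowerSeries.X i : MvPowerSeries (Fin 2) R) + W.formalIntercept =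
      W.formalW.subst (MvPowerSeries.X i : MvPowerSeries (Fin 2) R) := by
  fin_cases i
  · exact W.formalSlope_mul_X_zero_add_formalIntercept
  · exact W.formalSlope_mul_X_one_add_formalIntercept

variable [IsDomain R]

/-- **Vieta, product form: `D · w₁ w₂ w₃ = ν³`** (`wₖ = λzₖ + ν` the three collinear points; from the
coefficient identities `c₀ = −D z₁z₂z₃`, `c₁ = D Σ zₖzₗ`, `N = −D Σ zₖ` of the chord cubic — the value of
`λ³·G(Z, λZ+ν)` at `λZ + ν = 0`). [cite: SilvermanAEC2009, IV.1.1] -/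
theorem formalChordDenom_mul_prod_w :
    W.formalChordDenom * (W.formalSlope * (MvPowerSeries.X 0 : MvPowerSeries (Fin 2) R) + W.formalIntercept) *
        (W.formalSlope * (MvPowerSeries.X 1 : MvPowerSeries (Fin 2) R) + W.formalIntercept) *
        (W.formalSlope * W.formalChordZ + W.formalIntercept) =
      W.formalIntercept ^ 3 := by
  obtain ⟨hc₁, hc₀⟩ := W.formalChord_vieta_coeff
  have hDD' := W.formalChordDenom_mul_invOfUnit
  have hN : W.formalChordNum = -W.formalChordDenom *
      ((MvPowerSeries.X 0 : MvPowerSeries (Fin 2) R) + MvPowerSeries.X 1 + W.formalChordZ) := by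
    have hz₃ : W.formalChordZ = -(MvPowerSeries.X 0 : MvPowerSeries (Fin 2) R) - MvPowerSeries.X 1 -
        W.formalChordNum * MvPowerSeries.invOfUnit W.formalChordDenom 1 := rfl
    rw [hz₃]; linear_combination (-W.formalChordNum) * hDD'
  have hD : W.formalChordDenom = 1 + MvPowerSeries.C W.a₂ * W.formalSlope +
      MvPowerSeries.C W.a₄ * W.formalSlope ^ 2 + MvPowerSeries.C W.a₆ * W.formalSlope ^ 3 := rfl
  unfold WeierstrassCurve.formalChordNum at hN
  set L := W.formalSlope
  set V := W.formalIntercept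
  set D := W.formalChordDenom
  linear_combination (L ^ 3) * hc₀ - (L ^ 2 * V) * hc₁ + (L * V ^ 2) * hN + V ^ 3 * hD

/-- **The differentiated incidences**: `ηᵢ · ∂ᵢλ = D (zᵢ − z₃)` and `∂ᵢν = −zⱼ · ∂ᵢλ`
(`ηᵢ = η(zᵢ) = −Γ(zᵢ, wᵢ)`; from `D∏_{k≠l}(ζ_l − ζ_k)∂ᵢζ_l + Γ_l(ζ_l∂ᵢλ + ∂ᵢν) = 0` at `ζ = zᵢ` (`∂ᵢzᵢ = 1`) and
`ζ = zⱼ` (`∂ᵢzⱼ = 0`)). [cite: SilvermanAEC2009, III.5.1] -/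
theorem formalEta_mul_pderiv_formalSlope (i : Fin 2) :
    W.formalEta.subst (MvPowerSeries.X i : MvPowerSeries (Fin 2) R) * MvPowerSeries.pderiv i W.formalSlope =
        W.formalChordDenom * ((MvPowerSeries.X i : MvPowerSeries (Fin 2) R) - W.formalChordZ) ∧
      MvPowerSeries.pderiv i W.formalIntercept =
        -((MvPowerSeries.X 0 : MvPowerSeries (Fin 2) R) + MvPowerSeries.X 1 - MvPowerSeries.X i) *
          MvPowerSeries.pderiv i W.formalSlope := by
  classical
  have hΓ : ∀ j : Fin 2, (MvPowerSeries.C W.a₁ * ((MvPowerSeries.X j : MvPowerSeries (Fin 2) R)) +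
      MvPowerSeries.C W.a₂ * ((MvPowerSeries.X j : MvPowerSeries (Fin 2) R)) ^ 2 + 2 *
      MvPowerSeries.C W.a₃ * (W.formalW.subst (MvPowerSeries.X j : MvPowerSeries (Fin 2) R)) +
        2 * MvPowerSeries.C W.a₄ * ((MvPowerSeries.X j : MvPowerSeries (Fin 2) R)) *
            (W.formalW.subst (MvPowerSeries.X j : MvPowerSeries (Fin 2) R)) + 3 *
            MvPowerSeries.C W.a₆ *
            (W.formalW.subst (MvPowerSeries.X j : MvPowerSeries (Fin 2) R)) ^ 2 - 1) ≠ 0 := by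
    intro j hj
    have hw : MvPowerSeries.constantCoeff (W.formalW.subst (MvPowerSeries.X j : MvPowerSeries (Fin 2) R)) = 0 :=
      constantCoeff_powerSeries_subst_eq_zero (MvPowerSeries.constantCoeff_X j) W.constantCoeff_formalW
    have := congrArg MvPowerSeries.constantCoeff hj
    rw [W.constantCoeff_Gamma (MvPowerSeries.constantCoeff_X j) hw, map_zero] at this
    norm_num at this
  have h0 := W.chord_incidence_deriv (MvPowerSeries.pderiv i) (ζ := (MvPowerSeries.X 0 : MvPowerSeries (Fin 2) R))
    (by rw [W.formalSlope_mul_X_zero_add_formalIntercept]; exact W.curveCubic_formalW_subst_X 0)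
  have h1 := W.chord_incidence_deriv (MvPowerSeries.pderiv i) (ζ := (MvPowerSeries.X 1 : MvPowerSeries (Fin 2) R))
    (by rw [W.formalSlope_mul_X_one_add_formalIntercept]; exact W.curveCubic_formalW_subst_X 1)
  rw [W.formalSlope_mul_X_zero_add_formalIntercept, MvPowerSeries.pderiv_X] at h0
  rw [W.formalSlope_mul_X_one_add_formalIntercept, MvPowerSeries.pderiv_X] at h1
  rw [W.formalEta_subst (PowerSeries.HasSubst.X i)]
  fin_cases i
  · simp only [Fin.zero_eta, Fin.isValue, ↓reduceIte, mul_one, one_ne_zero, mul_zero, zero_add,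
      sub_self, zero_mul] at h0 h1 ⊢
    have hν : MvPowerSeries.pderiv 0 W.formalIntercept =
        -(MvPowerSeries.X 1 : MvPowerSeries (Fin 2) R) * MvPowerSeries.pderiv 0 W.formalSlope := by
      have := (mul_eq_zero.mp h1).resolve_left (hΓ 1)
      linear_combination this
    refine ⟨?_, by simpa using hν⟩
    rw [hν] at h0
    have h0' : ((MvPowerSeries.X 0 : MvPowerSeries (Fin 2) R) - MvPowerSeries.X 1) *
        (W.formalChordDenom * ((MvPowerSeries.X 0 : MvPowerSeries (Fin 2) R) - W.formalChordZ) +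
          (MvPowerSeries.C W.a₁ * (MvPowerSeries.X 0 : MvPowerSeries (Fin 2) R) +
      MvPowerSeries.C W.a₂ * (MvPowerSeries.X 0 : MvPowerSeries (Fin 2) R) ^ 2 + 2 *
      MvPowerSeries.C W.a₃ * (W.formalW.subst (MvPowerSeries.X 0 : MvPowerSeries (Fin 2) R)) +
        2 * MvPowerSeries.C W.a₄ * (MvPowerSeries.X 0 : MvPowerSeries (Fin 2) R) *
            (W.formalW.subst (MvPowerSeries.X 0 : MvPowerSeries (Fin 2) R)) + 3 *
            MvPowerSeries.C W.a₆ *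
            (W.formalW.subst (MvPowerSeries.X 0 : MvPowerSeries (Fin 2) R)) ^ 2 - 1) *
            MvPowerSeries.pderiv 0 W.formalSlope) = 0 := by
      linear_combination h0
    have := (mul_eq_zero.mp h0').resolve_left WeierstrassCurve.X_zero_sub_X_one_ne_zero
    linear_combination -this
  · simp only [Fin.mk_one, Fin.isValue, zero_ne_one, ↓reduceIte, mul_zero, zero_add, mul_one,
      sub_self, zero_mul] at h0 h1 ⊢
    have hν : MvPowerSeries.pderiv 1 W.formalIntercept =
        -(MvPowerSeries.X 0 : MvPowerSeries (Fin 2) R) * MvPowerSeries.pderiv 1 W.formalSlope := by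
      have := (mul_eq_zero.mp h0).resolve_left (hΓ 0)
      linear_combination this
    refine ⟨?_, by simpa using hν⟩
    rw [hν] at h1
    have h1' : ((MvPowerSeries.X 1 : MvPowerSeries (Fin 2) R) - MvPowerSeries.X 0) *
        (W.formalChordDenom * ((MvPowerSeries.X 1 : MvPowerSeries (Fin 2) R) - W.formalChordZ) +
          (MvPowerSeries.C W.a₁ * (MvPowerSeries.X 1 : MvPowerSeries (Fin 2) R) +
      MvPowerSeries.C W.a₂ * (MvPowerSeries.X 1 : MvPowerSeries (Fin 2) R) ^ 2 + 2 *
      MvPowerSeries.C W.a₃ * (W.formalW.subst (MvPowerSeries.X 1 : MvPowerSeries (Fin 2) R)) +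
        2 * MvPowerSeries.C W.a₄ * (MvPowerSeries.X 1 : MvPowerSeries (Fin 2) R) *
            (W.formalW.subst (MvPowerSeries.X 1 : MvPowerSeries (Fin 2) R)) + 3 *
            MvPowerSeries.C W.a₆ *
            (W.formalW.subst (MvPowerSeries.X 1 : MvPowerSeries (Fin 2) R)) ^ 2 - 1) *
            MvPowerSeries.pderiv 1 W.formalSlope) = 0 := by
      linear_combination h1
    have hne : (MvPowerSeries.X 1 : MvPowerSeries (Fin 2) R) - MvPowerSeries.X 0 ≠ 0 := fun h =>
      WeierstrassCurve.X_zero_sub_X_one_ne_zero (by linear_combination -h)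
    have := (mul_eq_zero.mp h1').resolve_left hne
    linear_combination -this

/-- `z₃ · (z₃² B(z₃)) = w₃ = λz₃ + ν` (`w = z³B`, and `w(z₃) = λz₃ + ν`). [cite: SilvermanAEC2009, IV.1.1] -/
theorem formalChordZ_mul_S₃ :
    W.formalChordZ * (W.formalChordZ ^ 2 * W.formalWDivCube.subst W.formalChordZ) =
      W.formalSlope * W.formalChordZ + W.formalIntercept := by
  have hg := W.hasSubst_formalChordZ
  rw [← W.formalW_subst_formalChordZ, W.formalW_eq_X_pow_mul_formalWDivCube, PowerSeries.subst_mul hg,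
    PowerSeries.subst_pow hg, PowerSeries.subst_X hg]
  ring

/-- **The algebraic bridge**: the power series
`Φ = a₁ − (a₁ + a₃λ + a₄ν + 2a₆λν)(1 − a₃ν − a₆ν²)⁻¹ + a₃ z₃²B(z₃)` satisfies
`F ν z₁z₂ · Φ = ν(z₁z₂ − F(z₁ + z₂)) − λ F z₁z₂`, i.e. "`Φ = 1/F − 1/z₁ − 1/z₂ − λ/ν`" (from `1/F = −u/z₃ =
−1/z₃ + a₁ + a₃w₃/z₃` and Vieta `D z₁z₂z₃ = ν(1 − a₃ν − a₆ν²)`, `D Σzₖzₗ = c₁`). [cite: SilvermanAEC2009, IV.1.1] -/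
theorem bridge :
    W.formalGroupLaw * W.formalIntercept * (MvPowerSeries.X 0 : MvPowerSeries (Fin 2) R) * MvPowerSeries.X 1 *
        (MvPowerSeries.C W.a₁ - (MvPowerSeries.C W.a₁ + MvPowerSeries.C W.a₃ * W.formalSlope +
            MvPowerSeries.C W.a₄ * W.formalIntercept + 2 * MvPowerSeries.C W.a₆ * W.formalSlope * W.formalIntercept) *
          MvPowerSeries.invOfUnit (1 - MvPowerSeries.C W.a₃ * W.formalIntercept -
            MvPowerSeries.C W.a₆ * W.formalIntercept ^ 2) 1 +
          MvPowerSeries.C W.a₃ * (W.formalChordZ ^ 2 * W.formalWDivCube.subst W.formalChordZ)) =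
      W.formalIntercept * ((MvPowerSeries.X 0 : MvPowerSeries (Fin 2) R) * MvPowerSeries.X 1 -
          W.formalGroupLaw * (MvPowerSeries.X 0 + MvPowerSeries.X 1)) -
        W.formalSlope * W.formalGroupLaw * MvPowerSeries.X 0 * MvPowerSeries.X 1 := by
  obtain ⟨hc₁, hc₀⟩ := W.formalChord_vieta_coeff
  have hFu := W.formalGroupLaw_mul_formalNegDenom
  have hS₃ := formalChordZ_mul_S₃ W
  have hM : (1 - MvPowerSeries.C W.a₃ * W.formalIntercept - MvPowerSeries.C W.a₆ * W.formalIntercept ^ 2) *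
      MvPowerSeries.invOfUnit (1 - MvPowerSeries.C W.a₃ * W.formalIntercept -
        MvPowerSeries.C W.a₆ * W.formalIntercept ^ 2) 1 = 1 :=
    MvPowerSeries.mul_invOfUnit _ 1 (by simp [W.constantCoeff_formalIntercept])
  -- cancel the non-zero-divisor `M · u · D`
  have hMne : (1 - MvPowerSeries.C W.a₃ * W.formalIntercept - MvPowerSeries.C W.a₆ * W.formalIntercept ^ 2) ≠ 0 := by
    intro h; have := congrArg MvPowerSeries.constantCoeff h
    simp [W.constantCoeff_formalIntercept] at this
  have hune : (1 - MvPowerSeries.C W.a₁ * W.formalChordZ -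
      MvPowerSeries.C W.a₃ * (W.formalSlope * W.formalChordZ + W.formalIntercept)) ≠ 0 :=
    W.isUnit_formalNegDenom_formalChordZ.ne_zero
  have hDne := W.formalChordDenom_ne_zero
  refine mul_right_cancel₀ (mul_ne_zero (mul_ne_zero hMne hune) hDne) ?_
  set S₃ := W.formalChordZ ^ 2 * W.formalWDivCube.subst W.formalChordZ
  set Mi := MvPowerSeries.invOfUnit (1 - MvPowerSeries.C W.a₃ * W.formalIntercept -
    MvPowerSeries.C W.a₆ * W.formalIntercept ^ 2) 1
  set F := W.formalGroupLaw
  set L := W.formalSlope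
  set V := W.formalIntercept
  set D := W.formalChordDenom
  set z₃ := W.formalChordZ
  set z₁ := (MvPowerSeries.X 0 : MvPowerSeries (Fin 2) R)
  set z₂ := (MvPowerSeries.X 1 : MvPowerSeries (Fin 2) R)
  set A₁ := (MvPowerSeries.C W.a₁ : MvPowerSeries (Fin 2) R)
  set A₃ := (MvPowerSeries.C W.a₃ : MvPowerSeries (Fin 2) R)
  set A₄ := (MvPowerSeries.C W.a₄ : MvPowerSeries (Fin 2) R)
  set A₆ := (MvPowerSeries.C W.a₆ : MvPowerSeries (Fin 2) R)
  linear_combination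
    (-(V * (A₁ * (1 - A₃ * V - A₆ * V ^ 2) - (A₁ + A₃ * L + A₄ * V + 2 * A₆ * L * V) +
          A₃ * S₃ * (1 - A₃ * V - A₆ * V ^ 2))) -
        (1 - A₃ * V - A₆ * V ^ 2) * (L - V * (A₁ + A₃ * S₃))) * hc₀ +
      ((1 - A₃ * V - A₆ * V ^ 2) * V) * hc₁ +
      (V * z₁ * z₂ * D * (A₁ * (1 - A₃ * V - A₆ * V ^ 2) - (A₁ + A₃ * L + A₄ * V + 2 * A₆ * L * V) +
          A₃ * S₃ * (1 - A₃ * V - A₆ * V ^ 2)) +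
        (1 - A₃ * V - A₆ * V ^ 2) * D * (V * (z₁ + z₂) + L * z₁ * z₂)) * hFu -
      (F * V * z₁ * z₂ * (1 - A₁ * z₃ - A₃ * (L * z₃ + V)) * D *
        (A₁ + A₃ * L + A₄ * V + 2 * A₆ * L * V)) * hM -
      ((1 - A₃ * V - A₆ * V ^ 2) * D * V * z₁ * z₂ * A₃) * hS₃

end TwoVariables

end Summit.BirchSwinnertonDyer.BirchSwinnertonDyer.Theorems.FormalEtaCoboundary

end
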